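import Summits.QuantumFields.YangMills.Theorems.LuscherReductionTwistedTraceScalingBTRatesCore
import HarnessLib

/-!
# (B-T) RATES, part 4: the relative rate `κ` of the schedule is `≤ β^{-2s}ℓ⁵`, and the record rate `btRate` satisfies `hκ0`, `hκ_dom`, `hκ_small`, `hr`, `hr_small`
# (lane A of S-BASE, crux `TwistedTraceScaling` stmt-QuantumFields-20203, C4-CORE, the (B-T) pen; design note `pub/ym-fleet/ym-luscher-20007-p1/COARSE-DESIGN.md` §25.9)

Pure real analysis.  `kappa_le_of_small` (`|e^η(1+ε₂+(ε₁+ε₂)²) − 1| + |e^{−η}(1−ε₂) − 1| ≤ 3η + 4ε₂ + 3(ε₁+ε₂)²` for `0 ≤ η, ε₂ ≤ 1`, `0 ≤ ε₁`), the nonnegativity of the three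
rates, ★★ `eventually_btKappa_le` (`κ(schedule) ≤ β^{-2s}ℓ⁵` eventually, `0 < s ≤ 1/4`, from the envelopes of `…BTRatesCore`), and the rate fields of `RecordAnalyticInput` for
`κ = btRate L s`: `btRate_nonneg` (hκ0), ★ `btRate_dom` (hκ_dom: `C(43β^{-s})² ≤ κ`), ★ `btRate_small` (hκ_small: `κ ≤ a·λ_b(L³β)` eventually, `1/6 < s ≤ 1/4`);
the radius fields `btRad_le_half` (hr) and ★ `eventually_btRad_small` (hr_small: `12|Site|·r < β^{-s}`, `s < 1/2`).
HONEST FRAMING: a stub of a child of the CONDITIONAL reduction route R2b1; C4-CORE OPEN; not infinite volume, not a gap, not Clay.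
-/

set_option autoImplicit false

noncomputable section

open MeasureTheory Filter Topology Real Asymptotics
open scoped BigOperators
open Literature.MathematicalPhysics.QuantumFieldTheory
open Literature.MathematicalPhysics.QuantumLattice

namespace Summit.QuantumFields.YangMills.Theorems.FemtoTransferGap.TwoLattice.ConstTube

open Summit.QuantumFields.YangMills.Theorems.FemtoTransferGap
open Summit.QuantumFields.YangMills.Theorems.FemtoTransferGap.TwoLattice
open Summit.QuantumFields.YangMills.Theorems.FemtoTransferGap.TwoLattice.Cov

variable {L : ℕ} [NeZero L]

/-! ## §1 The elementary estimate behind `κ` and the signs of the rates -/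

omit [NeZero L] in
/-- `|e^η(1+ε₂+(ε₁+ε₂)²) − 1| + |e^{−η}(1−ε₂) − 1| ≤ 3η + 4ε₂ + 3(ε₁+ε₂)²` for `0 ≤ η ≤ 1`, `0 ≤ ε₂ ≤ 1`. [folklore] -/
theorem kappa_le_of_small {η ε₁ ε₂ : ℝ} (hη0 : 0 ≤ η) (hη1 : η ≤ 1) (he2 : 0 ≤ ε₂) (he21 : ε₂ ≤ 1) :
    |Real.exp η * (1 + ε₂ + (ε₁ + ε₂) ^ 2) - 1| + |Real.exp (-η) * (1 - ε₂) - 1| ≤ 3 * η + 4 * ε₂ + 3 * (ε₁ + ε₂) ^ 2 := by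
  have hz : 0 ≤ ε₂ + (ε₁ + ε₂) ^ 2 := by positivity
  have hE1 : 1 ≤ Real.exp η := by linarith [Real.add_one_le_exp η]
  have hE2 : Real.exp η - 1 ≤ 2 * η := by
    have h := Real.abs_exp_sub_one_le (x := η) (by rw [abs_of_nonneg hη0]; exact hη1)
    rw [abs_of_nonneg hη0] at h
    exact (le_abs_self _).trans h
  have hA0 : 0 ≤ Real.exp η * (1 + ε₂ + (ε₁ + ε₂) ^ 2) - 1 := by nlinarith
  have hA : Real.exp η * (1 + ε₂ + (ε₁ + ε₂) ^ 2) - 1 ≤ 2 * η + 3 * (ε₂ + (ε₁ + ε₂) ^ 2) := by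
    have h3 : Real.exp η ≤ 3 := by linarith
    nlinarith
  have hEm1 : Real.exp (-η) ≤ 1 := by rw [Real.exp_le_one_iff]; linarith
  have hEm2 : 1 - η ≤ Real.exp (-η) := by linarith [Real.add_one_le_exp (-η)]
  have hB0 : Real.exp (-η) * (1 - ε₂) - 1 ≤ 0 := by nlinarith [Real.exp_pos (-η)]
  have hB : -(Real.exp (-η) * (1 - ε₂) - 1) ≤ η + ε₂ := by
    have h := mul_le_mul_of_nonneg_right hEm2 (by linarith : 0 ≤ 1 - ε₂)
    nlinarith
  rw [abs_of_nonneg hA0, abs_of_nonpos hB0]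
  linarith

/-- `0 ≤ ε₁` for nonnegative data. [folklore] -/
theorem coreEps1_nonneg {β δ T R : ℝ} (hβ : 0 ≤ β) (hδ : 0 ≤ δ) (hT : 0 ≤ T) : 0 ≤ coreEps1 L β δ T R := by
  unfold coreEps1; positivity

/-- `0 ≤ ε₂` for nonnegative data. [folklore] -/
theorem coreEps2_nonneg {β δ T R σ : ℝ} (hβ : 0 ≤ β) (hT : 0 ≤ T) (hσ : 0 ≤ σ) : 0 ≤ coreEps2 L β δ T R σ := by
  have := stepActionErr_nonneg (L := L) (σ := σ) hT
  have := stepActionErr_nonneg (L := L) (σ := 0) hT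
  unfold coreEps2; positivity

/-- `0 ≤ η` for nonnegative data. [folklore] -/
theorem coreEta_nonneg {β δ α T R Γ σ : ℝ} (hβ : 0 ≤ β) (hδ : 0 ≤ δ) (hα : 0 ≤ α) (hT : 0 ≤ T) (hΓ : 0 ≤ Γ) (hσ : 0 ≤ σ) :
    0 ≤ coreEta L β δ α T R Γ σ := by
  have := stepActionErr_nonneg (L := L) (σ := σ) hT
  unfold coreEta; positivity

/-! ## §2 ★★ `κ(schedule) ≤ β^{-2s}ℓ⁵` eventually -/

/-- ★★ **The relative rate of the schedule is `≤ β^{-2s}·ℓ⁵` eventually** (`0 < s ≤ 1/4`). [folklore] -/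
theorem eventually_btKappa_le {s : ℝ} (hs : 0 < s) (hs4 : s ≤ 1 / 4) :
    ∀ᶠ β : ℝ in atTop,
      btKappa L β (recordDelta1 L s β) (btAlpha β) (9 * L * btR1 β + btEps β) (btRad β) (btEps β * Fintype.card (Site 3 L))
          ((L : ℝ) ^ 3 * (12 * recordDelta1 L s β ^ 4)) ≤ powScale (2 * s) β * btLog β ^ 5 := by
  have hs2 : s < 1 / 2 := by linarith
  obtain ⟨K₁, hK₁, h₁⟩ := eventually_coreEps1_le (L := L) hs hs2
  obtain ⟨K₂, hK₂, h₂⟩ := eventually_coreEps2_le (L := L) hs hs2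
  obtain ⟨K₃, hK₃, h₃⟩ := eventually_coreEta_le (L := L) hs hs2
  set K : ℝ := 3 * K₃ + 4 * K₂ + 6 * K₁ ^ 2 + 6 * K₂ ^ 2 with hKdef
  have hK0 : 0 ≤ K := by rw [hKdef]; positivity
  have tW := tendsto_btW hs
  have t₂ := tW.const_mul K₂
  have t₃ := tW.const_mul K₃
  rw [mul_zero] at t₂ t₃
  filter_upwards [h₁, h₂, h₃, eventually_schedule_facts₂ (L := L) hs hs2, tW.eventually (eventually_le_nhds one_pos),
    t₂.eventually (eventually_le_nhds one_pos), t₃.eventually (eventually_le_nhds one_pos), eventually_ge_atTop (Real.exp (2 * K))]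
    with β e₁ e₂ e₃ hf hW1 hK₂W hK₃W hβK
  obtain ⟨hβ1, hℓeq, hℓ1, -, hδ0, -, -, hx0, -, hp2, hT0, -, -, -, -, hσ0, -⟩ := hf
  set W := (powScale (2 * s) β + powScale (1 / 2) β) * btLog β ^ 4 with hWdef
  set ε₁ := coreEps1 L β (recordDelta1 L s β) (9 * L * btR1 β + btEps β) (btRad β) with hε₁
  set ε₂ := coreEps2 L β (recordDelta1 L s β) (9 * L * btR1 β + btEps β) (btRad β) ((L : ℝ) ^ 3 * (12 * recordDelta1 L s β ^ 4)) with hε₂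
  set η := coreEta L β (recordDelta1 L s β) (btAlpha β) (9 * L * btR1 β + btEps β) (btRad β) (btEps β * Fintype.card (Site 3 L))
    ((L : ℝ) ^ 3 * (12 * recordDelta1 L s β ^ 4)) with hη
  have hβ0 : 0 ≤ β := by linarith
  have hε1_0 : 0 ≤ ε₁ := coreEps1_nonneg hβ0 hδ0 hT0
  have hε2_0 : 0 ≤ ε₂ := coreEps2_nonneg hβ0 hT0 hσ0
  have hη0 : 0 ≤ η := coreEta_nonneg hβ0 hδ0 (btAlpha_nonneg β) hT0 (mul_nonneg (btEps_pos_le β).1.le (Nat.cast_nonneg _)) hσ0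
  have hW0 : 0 ≤ W := by rw [hWdef]; have := powScale_pos (2 * s) β; positivity
  have hη1 : η ≤ 1 := e₃.trans hK₃W
  have hε21 : ε₂ ≤ 1 := e₂.trans hK₂W
  have hk : btKappa L β (recordDelta1 L s β) (btAlpha β) (9 * L * btR1 β + btEps β) (btRad β) (btEps β * Fintype.card (Site 3 L))
      ((L : ℝ) ^ 3 * (12 * recordDelta1 L s β ^ 4)) ≤ 3 * η + 4 * ε₂ + 3 * (ε₁ + ε₂) ^ 2 := by
    unfold btKappa; exact kappa_le_of_small hη0 hη1 hε2_0 hε21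
  -- the square
  have hpl : (powScale s β * btLog β ^ 2) ^ 2 ≤ W := by
    rw [mul_pow, ← pow_mul, hp2, hWdef]
    exact mul_le_mul_of_nonneg_right (le_add_of_nonneg_right hx0) (by positivity)
  have hWW : W ^ 2 ≤ W := by nlinarith
  have hsq : (ε₁ + ε₂) ^ 2 ≤ 2 * K₁ ^ 2 * W + 2 * K₂ ^ 2 * W := by
    have h := add_le_add e₁ e₂
    have h2 := pow_le_pow_left₀ (add_nonneg hε1_0 hε2_0) h 2
    calc (ε₁ + ε₂) ^ 2 ≤ (K₁ * (powScale s β * btLog β ^ 2) + K₂ * W) ^ 2 := h2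
      _ ≤ 2 * (K₁ * (powScale s β * btLog β ^ 2)) ^ 2 + 2 * (K₂ * W) ^ 2 := by
          have h0 := sq_nonneg (K₁ * (powScale s β * btLog β ^ 2) - K₂ * W)
          have e0 : (K₁ * (powScale s β * btLog β ^ 2) + K₂ * W) ^ 2 + (K₁ * (powScale s β * btLog β ^ 2) - K₂ * W) ^ 2 =
              2 * (K₁ * (powScale s β * btLog β ^ 2)) ^ 2 + 2 * (K₂ * W) ^ 2 := by ring
          linarith
      _ = 2 * K₁ ^ 2 * (powScale s β * btLog β ^ 2) ^ 2 + 2 * K₂ ^ 2 * W ^ 2 := by ring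
      _ ≤ 2 * K₁ ^ 2 * W + 2 * K₂ ^ 2 * W := add_le_add (mul_le_mul_of_nonneg_left hpl (by positivity)) (mul_le_mul_of_nonneg_left hWW (by positivity))
  have hκW : 3 * η + 4 * ε₂ + 3 * (ε₁ + ε₂) ^ 2 ≤ K * W := by
    have e : K * W = 3 * (K₃ * W) + 4 * (K₂ * W) + 3 * (2 * K₁ ^ 2 * W + 2 * K₂ ^ 2 * W) := by rw [hKdef]; ring
    rw [e]; linarith [e₂, e₃, hsq]
  -- `W ≤ 2β^{-2s}ℓ⁴` and `2K ≤ ℓ`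
  have hxp : powScale (1 / 2) β ≤ powScale (2 * s) β := powScale_le_powScale (by linarith) β
  have hp0 : 0 ≤ powScale (2 * s) β := (powScale_pos _ _).le
  have hl4 : 0 ≤ btLog β ^ 4 := by positivity
  have hW2 : W ≤ 2 * (powScale (2 * s) β * btLog β ^ 4) := by
    rw [hWdef]
    have h := mul_le_mul_of_nonneg_right (add_le_add_left hxp (powScale (2 * s) β)) hl4
    have e : (powScale (2 * s) β + powScale (2 * s) β) * btLog β ^ 4 = 2 * (powScale (2 * s) β * btLog β ^ 4) := by ring
    rw [e] at h; linarith
  have hℓK : 2 * K ≤ btLog β := by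
    rw [hℓeq, ← Real.log_exp (2 * K)]; exact Real.log_le_log (Real.exp_pos _) hβK
  calc _ ≤ 3 * η + 4 * ε₂ + 3 * (ε₁ + ε₂) ^ 2 := hk
    _ ≤ K * W := hκW
    _ ≤ K * (2 * (powScale (2 * s) β * btLog β ^ 4)) := mul_le_mul_of_nonneg_left hW2 hK0
    _ = 2 * K * (powScale (2 * s) β * btLog β ^ 4) := by ring
    _ ≤ btLog β * (powScale (2 * s) β * btLog β ^ 4) := mul_le_mul_of_nonneg_right hℓK (by positivity)
    _ = powScale (2 * s) β * btLog β ^ 5 := by ring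

/-! ## §3 The record rate `btRate`: hκ0, hκ_dom, hκ_small -/

/-- hκ0: `0 ≤ btRate`. [folklore] -/
theorem btRate_nonneg (s β : ℝ) : 0 ≤ btRate L s β := by
  unfold btRate btKappa
  exact add_nonneg (add_nonneg (by positivity) (powScale_pos _ _).le) (mul_nonneg (powScale_pos _ _).le (pow_nonneg (zero_le_one.trans (one_le_btLog β)) 5))

/-- ★ hκ_dom: `C·(43β^{-s})² ≤ btRate` eventually, for every real `C`. [folklore] -/
theorem btRate_dom (s C : ℝ) : ∀ᶠ β : ℝ in atTop, C * (43 * powScale s β) ^ 2 ≤ btRate L s β := by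
  filter_upwards [eventually_ge_atTop (1 : ℝ), eventually_ge_atTop (Real.exp (1849 * |C|)), eventually_btLog_eq] with β hβ1 hβC hℓ
  have hβ0 : 0 ≤ β := by linarith
  have hp2 : powScale s β ^ 2 = powScale (2 * s) β := by
    rw [powScale_eq hβ1, powScale_eq hβ1, ← Real.rpow_mul_natCast hβ0]; congr 1; push_cast; ring
  have hℓC : 1849 * |C| ≤ btLog β := by rw [hℓ, ← Real.log_exp (1849 * |C|)]; exact Real.log_le_log (Real.exp_pos _) hβC
  have hl5 : btLog β ≤ btLog β ^ 5 := le_self_pow₀ (one_le_btLog β) (by norm_num)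
  have hp0 : 0 ≤ powScale s β ^ 2 := sq_nonneg _
  have hκ : 0 ≤ btKappa L β (recordDelta1 L s β) (btAlpha β) (9 * L * btR1 β + btEps β) (btRad β) (btEps β * Fintype.card (Site 3 L))
      ((L : ℝ) ^ 3 * (12 * recordDelta1 L s β ^ 4)) := by unfold btKappa; positivity
  have hε : 0 ≤ powScale 1 β := (powScale_pos _ _).le
  unfold btRate
  rw [← hp2]
  calc C * (43 * powScale s β) ^ 2 = 1849 * C * powScale s β ^ 2 := by ring
    _ ≤ 1849 * |C| * powScale s β ^ 2 := by gcongr; exact le_abs_self C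
    _ ≤ btLog β ^ 5 * powScale s β ^ 2 := mul_le_mul_of_nonneg_right (hℓC.trans hl5) hp0
    _ ≤ _ := by nlinarith

/-- ★ hκ_small: `btRate ≤ a·λ_b(L³β)` eventually for every `a > 0` (`1/6 < s ≤ 1/4`). [folklore] -/
theorem btRate_small {s : ℝ} (hs6 : 1 / 6 < s) (hs4 : s ≤ 1 / 4) (a : ℝ) (ha : 0 < a) :
    ∀ᶠ β : ℝ in atTop, btRate L s β ≤ a * bareLambda ((L : ℝ) ^ 3 * β) := by
  have hs0 : 0 < s := by linarith
  have hL0 : (0 : ℝ) < L := by exact_mod_cast NeZero.pos L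
  set cL : ℝ := (2 / (L : ℝ) ^ 3) ^ ((1 : ℝ) / 3) with hcL
  have hcL0 : 0 < cL := by rw [hcL]; positivity
  have t := tendsto_powScale_mul_btLog_pow (show (0 : ℝ) < 2 * s - 1 / 3 by linarith) 5
  filter_upwards [eventually_btKappa_le (L := L) hs0 hs4, t.eventually (eventually_le_nhds (show (0 : ℝ) < a * cL / 3 by positivity)),
    eventually_ge_atTop (1 : ℝ)] with β hκ hsm hβ1
  have hβ0 : 0 < β := by linarith
  have hl5 : 1 ≤ btLog β ^ 5 := one_le_pow₀ (one_le_btLog β)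
  have hp0 : 0 ≤ powScale (2 * s) β := (powScale_pos _ _).le
  have hA : powScale 1 β ≤ powScale (2 * s) β * btLog β ^ 5 :=
    (powScale_le_powScale (show 2 * s ≤ 1 by linarith) β).trans (le_mul_of_one_le_right hp0 hl5)
  have h3 : btRate L s β ≤ 3 * (powScale (2 * s) β * btLog β ^ 5) := by unfold btRate; linarith
  have hsplit : powScale (2 * s) β = powScale (2 * s - 1 / 3) β * β ^ (-(1 : ℝ) / 3) := by
    rw [powScale_eq hβ1, powScale_eq hβ1, ← Real.rpow_add hβ0]; congr 1; ring
  have hb3 : 0 ≤ β ^ (-(1 : ℝ) / 3) := (Real.rpow_pos_of_pos hβ0 _).le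
  rw [bareLambda_cube_eq (L := L) hβ0, ← hcL]
  calc btRate L s β ≤ 3 * (powScale (2 * s) β * btLog β ^ 5) := h3
    _ = 3 * (powScale (2 * s - 1 / 3) β * btLog β ^ 5) * β ^ (-(1 : ℝ) / 3) := by rw [hsplit]; ring
    _ ≤ 3 * (a * cL / 3) * β ^ (-(1 : ℝ) / 3) := mul_le_mul_of_nonneg_right (mul_le_mul_of_nonneg_left hsm (by norm_num)) hb3
    _ = a * (cL * β ^ (-(1 : ℝ) / 3)) := by ring

/-! ## §4 The radius fields hr, hr_small -/

omit [NeZero L] in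
/-- hr: `0 ≤ btRad ≤ 1/2`. [folklore] -/
theorem btRad_le_half (β : ℝ) : 0 ≤ btRad β ∧ btRad β ≤ 1 / 2 := ⟨(btRad_pos_le β).1.le, by linarith [(btRad_pos_le β).2]⟩

/-- ★ hr_small: `12|Site|·btRad β < β^{-s}` eventually (`0 < s < 1/2`). [folklore] -/
theorem eventually_btRad_small {s : ℝ} (hs2 : s < 1 / 2) : ∀ᶠ β : ℝ in atTop, 12 * Fintype.card (Site 3 L) * btRad β < powScale s β := by
  have hN : (0 : ℝ) < Fintype.card (Site 3 L) := by exact_mod_cast Fintype.card_pos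
  have hs2' : (0 : ℝ) < 1 / 2 - s := by linarith
  filter_upwards [eventually_ge_atTop (1 : ℝ), eventually_btRad_eq,
    (tendsto_powScale hs2').eventually (eventually_lt_nhds (show (0 : ℝ) < 1 / (12 * Fintype.card (Site 3 L)) by positivity))] with β hβ1 hreq hrat
  have e : powScale (1 / 2) β = powScale (1 / 2 - s) β * powScale s β := by
    rw [powScale_eq hβ1, powScale_eq hβ1, powScale_eq hβ1, ← Real.rpow_add (by linarith)]; ring_nf
  rw [hreq, e]
  have hp : 0 < powScale s β := powScale_pos _ _
  have h1 : 12 * Fintype.card (Site 3 L) * powScale (1 / 2 - s) β < 1 := by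
    have := mul_lt_mul_of_pos_left hrat (show (0 : ℝ) < 12 * Fintype.card (Site 3 L) by positivity)
    rwa [show 12 * (Fintype.card (Site 3 L) : ℝ) * (1 / (12 * Fintype.card (Site 3 L))) = 1 by field_simp] at this
  calc 12 * Fintype.card (Site 3 L) * (powScale (1 / 2 - s) β * powScale s β) = (12 * Fintype.card (Site 3 L) * powScale (1 / 2 - s) β) * powScale s β := by ring
    _ < 1 * powScale s β := mul_lt_mul_of_pos_right h1 hp
    _ = powScale s β := one_mul _

end Summit.QuantumFields.YangMills.Theorems.FemtoTransferGap.TwoLattice.ConstTube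

end
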